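import Literature.NumberTheory.Sieve.HeathBrownCubicGrossenCharPNT
import Literature.NumberTheory.LFunctions.RayClassOfIdealHom
import Literature.NumberTheory.LFunctions.RayClassLSeriesNonvanishing
import Literature.NumberTheory.LFunctions.LSeriesRealReflection
import HarnessLib

/-!
# Heath-Brown's real characters `ν^{(0,0)}` as ray class characters `mod (q)`: `L(1, ν) ≠ 0`

Sequel of `HeathBrownCubicGrossenLFunction` / `HeathBrownCubicGrossenCharPNT` on the way to an UNCONDITIONAL
Lemma 9.4 of D. R. Heath-Brown, *Primes represented by `x³ + 2y³`*, Acta Math. 186 (2001) (T. Mitsui's prime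
number theorem with Grössencharakteren; the tree's `grossenCharPNT_of_realZero_bound` still carries Siegel's
real-zero bound for the characters `χ mod q` with `χ² = 1`, `χ(ε₀) = 1` as a hypothesis). Page 55: "since we
are allowing `q` to tend to infinity … it is the possible existence of Siegel zeros that is of concern", and
Harman, *Prime-Detecting Sieves*, p. 283: "the familiar arguments concerning Siegel zeros". Those arguments
(`SiegelTheoremAbstract`, `SiegelRealZerosAbstract`) need `L(1, χ) ≠ 0`, which the tree proves for Neukirch's
narrow ray class characters (`RayClassLSeriesNonvanishing`, from Hecke's entire continuation and Landau's
lemma). This pure-proof file (theorems only) identifies the two worlds for `K = ℚ(∛2)`: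

* `grossenChar_zero_zero_of_ne_bot`, `nu0O_of_charAngle_eq_zero` — for `t(χ) = 0` (`charAngle χ = 0`, i.e.
  `χ(u_E) = 1`), `ν^{(0,0)}((β)) = χ(β mod q)·sgn(σ₁β)^{s(χ)}` depends only on `β mod q` and on the sign of
  the real embedding `σ₁ = realEmbK` (`realEmbK_coe`): **`isRayClassCharacter_grossenChar`** — the prime values
  `𝔭 ↦ ν^{(0,0)}(𝔭)` form a narrow ray class character `mod (q)` in the sense of `IsRayClassCharacter`
  (Neukirch VII (6.8): values in `S¹` off `(q)`, and `χ((b)) = χ((c))` for `b ≡ c mod (q)`, `b/c ≫ 0`);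
* `grossenL_eq_rayClassLSeries` — `L(s, ν^{(j,k)}) = L_{(q)}(𝔭 ↦ ν(𝔭), s)` for `Re s > 1`
  (`rayClassLSeries_apply_asIdeal_eq`: `ν` vanishes off the ideals prime to `q`);
* `exists_prime_grossenChar_ne_one` — a non-trivial `ν^{(j,k)} mod q` is `≠ 1` at some prime `𝔭 ∤ q`;
* **`grossenL_one_ne_zero`** — for `χ ≠ χ₀` with `t(χ) = 0`: `L(1, ν^{(0,0)}) ≠ 0` (Hecke–Landau's
  `exists_entire_eq_rayClassLSeries_and_apply_one_ne_zero` and the identity theorem on `Re s > 8/9`,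
  `eqOn_halfPlane_of_eqOn`), and `exists_entire_eq_grossenL` — `L(s, ν^{(0,0)})` is the restriction of an
  entire function;
* `mulChar_apply_mem_of_sq_eq_one`, `grossenChar_mem_of_sq_eq_one`, `conj_twistCount_grossenChar`,
  **`grossenL_ofReal_im`** — for `χ² = 1`, `t(χ) = 0` the values of `ν^{(0,0)}` lie in `{0, ±1}`, so
  `L(σ, ν)` is real for real `σ > 8/9` (`halfPlane_continuation_ofReal_im_eq_zero`);
* `norm_sum_twistedCoeff_le_linear`, **`exists_norm_grossenL_le_rpow`** — the
  conductor-aspect bound near `s = 1` that Siegel's argument consumes (`SiegelRealZerosAbstract`, hypothesis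
  `hloc`; field `L_one_le`): for `0 < δ ≤ 3` there is `T(δ)` with
  `‖L(s, ν^{(0,0)})‖ ≤ T(δ) q^δ (|Im s| + 1)` for `1 − δ/54 ≤ Re s ≤ 4`, every `q` and every `χ ≠ χ₀ mod q`
  — by interpolating the trivial bound `|∑_{N𝔞≤N} ν(𝔞)| ≤ c_K N` (ideal counting,
  `exists_card_idealsUpTo_approx`) with `≤ C q³N^{8/9}` (`exists_sum_twistedCoeff_bound`) to
  `≤ c_K^{1−t}(Cq³)^t N^{1−t/9}`, `t = δ/3`, and continuing by partial summation (`norm_contF_le`).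

## References

* D. R. Heath-Brown, *Primes represented by `x³ + 2y³`*, Acta Math. 186 (2001), §9 (9.1)–(9.2), Lemma 9.4,
  p. 55. [cite: HeathBrownActa2001, §9 Lemma 9.4]
* T. Mitsui, *Generalized prime number theorem*, Jap. J. Math. 26 (1956), 1–42, Lemma 5. [cite: Mitsui1956, Lemma 5]
* J. Neukirch, *Algebraic Number Theory*, Springer 1999, Ch. VII §6 (6.8), §8 (8.5). [cite: NeukirchANT1999, Ch. VII §6 Def. (6.8)]
* H. L. Montgomery, R. C. Vaughan, *Multiplicative Number Theory I*, CUP 2007, §11.2 (proof of Cor. 11.15).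
  [cite: MontgomeryVaughan2007, §11.2 Corollary 11.15]

## Mathlib / tree search

Tree: `grossenChar`, `grossenChar_span`, `grossenChar_of_ne_bot`, `nuO`, `nu0O`, `charSign`, `charAngle`,
`norm_mulChar_apply_units`, `isUnit_toQuotMod_idealGen_iff`, `grossenChar_eq_zero_of_not_coprime`, `idealGen_ne_zero`,
`IsTrivialMod` (`HeathBrownCubicGrossen`), `isTrivialMod_iff` (`HeathBrownCubicGrossenTrivial`), `realEmbK_coe`
(`HeathBrownCubicRegulator`), `grossenL`, `grossenL_eq_LSeries`, `differentiableOn_grossenL`, `twistedCoeff`,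
`norm_twistedCoeff_le`, `exists_sum_twistedCoeff_bound`, `abs_thetaOf_le` (`HeathBrownCubicGrossenLFunction`),
`exists_card_idealsUpTo_approx`, `card_idealsUpTo_eq` (`HeathBrownCubicGrossenCharPNT`), `norm_contF_le`
(`LSeriesContinuationOfPartialSums`), `exists_entire_eq_rayClassLSeries_and_apply_one_ne_zero`
(`RayClassLSeriesNonvanishing`), `halfPlane_continuation_ofReal_im_eq_zero` (`LSeriesRealReflection`),
`idealPow_apply_asIdeal`, `rayClassLSeries_apply_asIdeal_eq`, `idealPow_congr_of_isCoprime`, `eqOn_halfPlane_of_eqOn`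
(`RayClassOfIdealHom`). Mathlib: `MulChar.pow_apply_coe`, `MulChar.one_apply_coe`, `sq_eq_one_iff`,
`Ideal.Quotient.eq`, `Real.rpow_le_rpow`, `Real.mul_rpow`, `Real.rpow_natCast`, `Real.rpow_mul`.
-/

noncomputable section

open NumberField Finset Complex Set IsDedekindDomain
open scoped ComplexConjugate

namespace Literature.NumberTheory.Sieve.CubicSieve

open LFunctions LFunctions.NumberField LFunctions.CubeRootTwoField CubicPrimes LFunctions.PartialSumContinuation

variable {q : ℕ}

/-! ### The values of `ν^{(0,0)}` -/

/-- `ν^{(0,0)}(S) = ν₀(generator of S)` for `S ≠ 0`. [cite: HeathBrownActa2001, §9 p. 54] -/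
theorem grossenChar_zero_zero_of_ne_bot (hq : 1 ≤ q) (χ : MulChar (QuotMod q) ℂ) {S : Ideal (𝓞 K)}
    (hS : S ≠ ⊥) : grossenChar hq χ 0 0 S = nu0O χ (idealGen S) := by
  rw [grossenChar_of_ne_bot hq χ 0 0 hS, nuO, zpow_zero, zpow_zero, mul_one, mul_one]

/-- `ν^{(0,0)}((β)) = ν₀(β)` for `β ≠ 0`. [cite: HeathBrownActa2001, §9 p. 53] -/
theorem grossenChar_zero_zero_span (hq : 1 ≤ q) (χ : MulChar (QuotMod q) ℂ) {β : 𝓞 K} (hβ : β ≠ 0) :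
    grossenChar hq χ 0 0 (Ideal.span {β}) = nu0O χ β := by
  rw [grossenChar_span hq χ 0 0 hβ, zpow_zero, zpow_zero, mul_one, mul_one]

/-- For `t(χ) = 0`: `ν₀(β) = χ(β mod q)·(σ₁β/|σ₁β|)^{s(χ)}`. [cite: HeathBrownActa2001, §9 (9.2)] -/
theorem nu0O_of_charAngle_eq_zero {χ : MulChar (QuotMod q) ℂ} (ht : charAngle χ = 0) (β : 𝓞 K) :
    nu0O χ β = χ (toQuotMod q β) * ((ellO β / |ellO β| : ℝ) : ℂ) ^ charSign χ := by
  rw [nu0O, ht]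
  simp

/-- The sign factor `σ₁β/|σ₁β|` is `0`, `1` or `−1`. [folklore] -/
theorem sign_ratio_mem (x : ℝ) : x / |x| = 0 ∨ x / |x| = 1 ∨ x / |x| = -1 := by
  rcases lt_trichotomy x 0 with h | h | h
  · right; right; rw [abs_of_neg h, div_neg, div_self h.ne]
  · left; rw [h, abs_zero, div_zero]
  · right; left; rw [abs_of_pos h, div_self h.ne']

/-- For a character with `χ² = 1`, every value `χ(x)` is `0`, `1` or `−1`. [folklore] -/
theorem mulChar_apply_mem_of_sq_eq_one {χ : MulChar (QuotMod q) ℂ} (h2 : χ ^ 2 = 1) (x : QuotMod q) :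
    χ x = 0 ∨ χ x = 1 ∨ χ x = -1 := by
  by_cases hx : IsUnit x
  · obtain ⟨u, rfl⟩ := hx
    have h : χ u ^ 2 = 1 := by rw [← MulChar.pow_apply_coe, h2, MulChar.one_apply_coe]
    right
    exact sq_eq_one_iff.mp h
  · left; exact MulChar.map_nonunit χ hx

/-- Products of elements of `{0, 1, −1}` lie in `{0, 1, −1}`. [folklore] -/
theorem mul_mem_signSet {a b : ℂ} (ha : a = 0 ∨ a = 1 ∨ a = -1) (hb : b = 0 ∨ b = 1 ∨ b = -1) :
    a * b = 0 ∨ a * b = 1 ∨ a * b = -1 := by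
  rcases ha with rfl | rfl | rfl <;> rcases hb with rfl | rfl | rfl <;> simp

/-- For `χ² = 1`, `t(χ) = 0`: `ν₀(β) ∈ {0, 1, −1}`. [cite: HeathBrownActa2001, §9 p. 55] -/
theorem nu0O_mem_of_sq_eq_one {χ : MulChar (QuotMod q) ℂ} (h2 : χ ^ 2 = 1) (ht : charAngle χ = 0) (β : 𝓞 K) :
    nu0O χ β = 0 ∨ nu0O χ β = 1 ∨ nu0O χ β = -1 := by
  rw [nu0O_of_charAngle_eq_zero ht]
  refine mul_mem_signSet (mulChar_apply_mem_of_sq_eq_one h2 _) ?_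
  have hr : ((ellO β / |ellO β| : ℝ) : ℂ) = 0 ∨ ((ellO β / |ellO β| : ℝ) : ℂ) = 1 ∨
      ((ellO β / |ellO β| : ℝ) : ℂ) = -1 := by
    rcases sign_ratio_mem (ellO β) with h | h | h <;> simp [h]
  rcases Nat.le_one_iff_eq_zero_or_eq_one.mp (charSign_le_one χ) with hs | hs
  · rw [hs, pow_zero]; simp
  · rw [hs, pow_one]; exact hr

/-- **For `χ² = 1`, `t(χ) = 0` the character `ν^{(0,0)}` takes values in `{0, 1, −1}`** (a real character).
[cite: HeathBrownActa2001, §9 p. 55] -/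
theorem grossenChar_mem_of_sq_eq_one (hq : 1 ≤ q) {χ : MulChar (QuotMod q) ℂ} (h2 : χ ^ 2 = 1)
    (ht : charAngle χ = 0) (S : Ideal (𝓞 K)) :
    grossenChar hq χ 0 0 S = 0 ∨ grossenChar hq χ 0 0 S = 1 ∨ grossenChar hq χ 0 0 S = -1 := by
  by_cases hS : S = ⊥
  · left; rw [hS, grossenChar_bot]
  · rw [grossenChar_zero_zero_of_ne_bot hq χ hS]; exact nu0O_mem_of_sq_eq_one h2 ht _

/-- Hence the Dirichlet coefficients `∑_{N𝔞=n} ν(𝔞)` are real. [folklore] -/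
theorem conj_twistCount_grossenChar (hq : 1 ≤ q) {χ : MulChar (QuotMod q) ℂ} (h2 : χ ^ 2 = 1)
    (ht : charAngle χ = 0) (n : ℕ) :
    conj (twistCount K (grossenChar hq χ 0 0) n) = twistCount K (grossenChar hq χ 0 0) n := by
  rw [twistCount, map_sum]
  refine Finset.sum_congr rfl fun S _ => ?_
  rcases grossenChar_mem_of_sq_eq_one hq h2 ht S with h | h | h <;> rw [h] <;> simp

/-! ### `ν^{(0,0)}` is a narrow ray class character `mod (q)` -/

/-- A prime not containing `(q)` is prime to `(q)`. [folklore] -/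
theorem sup_span_eq_top_of_not_le (hq : 1 ≤ q) {v : HeightOneSpectrum (𝓞 K)}
    (hv : ¬ Ideal.span {((q : ℕ) : 𝓞 K)} ≤ v.asIdeal) :
    v.asIdeal ⊔ Ideal.span {((q : ℕ) : 𝓞 K)} = ⊤ := by
  rw [← Ideal.isCoprime_iff_sup_eq, isCoprime_iff_forall_not_le (span_natCast_ne_bot_of_one_le hq)]
  intro w hw hvw
  have : v.asIdeal = w.asIdeal := v.isMaximal.eq_of_le w.isPrime.ne_top hvw
  exact hv (this ▸ hw)

/-- `ν^{(j,k)}` vanishes off the ideals prime to `(q)`. [cite: HeathBrownActa2001, §9 p. 53] -/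
theorem grossenChar_eq_zero_of_not_isCoprime (hq : 1 ≤ q) (χ : MulChar (QuotMod q) ℂ) (j k : ℤ)
    (I : Ideal (𝓞 K)) (hI : ¬ IsCoprime I (Ideal.span {((q : ℕ) : 𝓞 K)})) : grossenChar hq χ j k I = 0 :=
  grossenChar_eq_zero_of_not_coprime hq χ j k fun h => hI (Ideal.isCoprime_iff_sup_eq.mpr h)

/-- **`L(s, ν^{(j,k)}) = L_{(q)}(𝔭 ↦ ν(𝔭), s)` for `Re s > 1`** (`ν` non-trivial): Heath-Brown's `L`-function is
Neukirch's ray-class `L`-series of the prime values of `ν`. [cite: NeukirchANT1999, Ch. VII §8 (8.1) Proposition] -/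
theorem grossenL_eq_rayClassLSeries (hq : 1 ≤ q) (χ : MulChar (QuotMod q) ℂ) (j k : ℤ)
    (hν : ¬ IsTrivialMod q (grossenChar hq χ j k)) {s : ℂ} (hs : 1 < s.re) :
    grossenL hq χ j k s =
      rayClassLSeries (Ideal.span {((q : ℕ) : 𝓞 K)}) (fun v => grossenChar hq χ j k v.asIdeal) s := by
  rw [grossenL_eq_LSeries hq χ j k hν hs, rayClassLSeries_apply_asIdeal_eq (grossenChar hq χ j k)
    (norm_grossenChar_le hq χ j k) (grossenChar_eq_zero_of_not_isCoprime hq χ j k) hs]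

/-- **`𝔭 ↦ ν^{(0,0)}(𝔭)` is a narrow ray class character `mod (q)`** when `t(χ) = 0`: `|ν(𝔭)| = 1` for `𝔭 ∤ q`,
and `ν((b)) = ν((c))` for `b ≡ c mod q` with `σ₁(b)σ₁(c) > 0` (the value `χ(β mod q)·sgn(σ₁β)^s` only depends
on these data). [cite: NeukirchANT1999, Ch. VII §6 Def. (6.8)] -/
theorem isRayClassCharacter_grossenChar (hq : 1 ≤ q) {χ : MulChar (QuotMod q) ℂ} (ht : charAngle χ = 0) :
    IsRayClassCharacter (Ideal.span {((q : ℕ) : 𝓞 K)}) (fun v => grossenChar hq χ 0 0 v.asIdeal) where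
  norm_eq_one v hv := by
    have hcop := sup_span_eq_top_of_not_le hq hv
    have hunit : IsUnit (toQuotMod q (idealGen v.asIdeal)) := (isUnit_toQuotMod_idealGen_iff _).mpr hcop
    have hg : idealGen v.asIdeal ≠ 0 := idealGen_ne_zero v.ne_bot
    show ‖grossenChar hq χ 0 0 v.asIdeal‖ = 1
    rw [grossenChar_zero_zero_of_ne_bot hq χ v.ne_bot, nu0O_of_charAngle_eq_zero ht, norm_mul, norm_pow]
    obtain ⟨x, hx⟩ := hunit
    rw [← hx, norm_mulChar_apply_units hq χ x, one_mul, Complex.norm_real, Real.norm_eq_abs, abs_div, abs_abs,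
      div_self (abs_ne_zero.mpr (ellO_ne_zero hg)), one_pow]
  idealPow_span_eq b c hb hc _ hbc hpos := by
    have hb' : Ideal.span {b} ≠ ⊥ := by rwa [Ne, Ideal.span_singleton_eq_bot]
    have hc' : Ideal.span {c} ≠ ⊥ := by rwa [Ne, Ideal.span_singleton_eq_bot]
    rw [idealPow_apply_asIdeal (grossenChar hq χ 0 0) hb', idealPow_apply_asIdeal (grossenChar hq χ 0 0) hc',
      grossenChar_zero_zero_span hq χ hb, grossenChar_zero_zero_span hq χ hc, nu0O_of_charAngle_eq_zero ht,
      nu0O_of_charAngle_eq_zero ht]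
    have hmod : toQuotMod q b = toQuotMod q c := (Ideal.Quotient.eq).mpr hbc
    have hsign : ellO b / |ellO b| = ellO c / |ellO c| := by
      have h := hpos realEmbK
      rw [realEmbK_coe, realEmbK_coe] at h
      have hb0 := ellO_ne_zero hb
      have hc0 := ellO_ne_zero hc
      rcases lt_or_gt_of_ne hb0 with hbn | hbp
      · have hcn : ellO c < 0 := by
          by_contra hcn; push Not at hcn
          nlinarith [mul_nonneg_of_nonpos_of_nonpos hbn.le (le_refl 0), hcn]
        rw [abs_of_neg hbn, abs_of_neg hcn, div_neg, div_neg, div_self hb0, div_self hc0]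
      · have hcp : 0 < ellO c := by
          by_contra hcp; push Not at hcp
          nlinarith
        rw [abs_of_pos hbp, abs_of_pos hcp, div_self hb0, div_self hc0]
    rw [hmod, hsign]

/-- For `χ² = 1`, `t(χ) = 0`: the prime values off `(q)` are `±1`. [cite: HeathBrownActa2001, §9 p. 55] -/
theorem grossenChar_prime_eq_one_or (hq : 1 ≤ q) {χ : MulChar (QuotMod q) ℂ} (h2 : χ ^ 2 = 1) (ht : charAngle χ = 0)
    (v : HeightOneSpectrum (𝓞 K)) (hv : ¬ Ideal.span {((q : ℕ) : 𝓞 K)} ≤ v.asIdeal) :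
    grossenChar hq χ 0 0 v.asIdeal = 1 ∨ grossenChar hq χ 0 0 v.asIdeal = -1 := by
  have h1 : ‖grossenChar hq χ 0 0 v.asIdeal‖ = 1 := (isRayClassCharacter_grossenChar hq ht).norm_eq_one v hv
  rcases grossenChar_mem_of_sq_eq_one hq h2 ht v.asIdeal with h | h | h
  · rw [h, norm_zero] at h1; exact absurd h1 zero_ne_one
  · exact Or.inl h
  · exact Or.inr h

/-- **A non-trivial `ν^{(j,k)} mod q` differs from `1` at some prime `𝔭 ∤ q`** (else, by multiplicativity, it
would be `1` on every ideal prime to `q`). [cite: HeathBrownActa2001, §9 p. 54] -/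
theorem exists_prime_grossenChar_ne_one (hq : 1 ≤ q) (χ : MulChar (QuotMod q) ℂ) (j k : ℤ)
    (hν : ¬ IsTrivialMod q (grossenChar hq χ j k)) :
    ∃ v : HeightOneSpectrum (𝓞 K), ¬ Ideal.span {((q : ℕ) : 𝓞 K)} ≤ v.asIdeal ∧ grossenChar hq χ j k v.asIdeal ≠ 1 := by
  by_contra hall
  push Not at hall
  apply hν
  intro S hS hScop
  have hq0 := span_natCast_ne_bot_of_one_le hq
  have hcop : IsCoprime S (Ideal.span {((q : ℕ) : 𝓞 K)}) := Ideal.isCoprime_iff_sup_eq.mpr hScop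
  rw [← idealPow_apply_asIdeal (grossenChar hq χ j k) hS,
    idealPow_congr_of_isCoprime hq0 (ψ' := fun _ => (1 : ℂ)) (fun v hv => hall v hv) hS hcop]
  unfold idealPow
  simp only [one_pow]
  exact finprod_one

/-! ### `L(1, ν^{(0,0)}) ≠ 0` and an entire continuation -/

/-- **`L(s, ν^{(0,0)})` is the restriction of an entire function** (Hecke's continuation of the ray class
`L`-series, `exists_differentiable_eq_rayClassLSeries`, glued by the identity theorem on `Re s > 8/9`), which
does not vanish at `s = 1`. [cite: NeukirchANT1999, Ch. VII §8 Thm. (8.5)] -/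
theorem exists_entire_eq_grossenL (hq : 1 ≤ q) {χ : MulChar (QuotMod q) ℂ} (hχ : χ ≠ 1) (ht : charAngle χ = 0) :
    ∃ G : ℂ → ℂ, Differentiable ℂ G ∧ (∀ s : ℂ, 8 / 9 < s.re → G s = grossenL hq χ 0 0 s) ∧ G 1 ≠ 0 := by
  have hν : ¬ IsTrivialMod q (grossenChar hq χ 0 0) := fun h => hχ ((isTrivialMod_iff hq).mp h).1
  have hq0 := span_natCast_ne_bot_of_one_le hq
  obtain ⟨G, hGd, hGeq, hG1⟩ := exists_entire_eq_rayClassLSeries_and_apply_one_ne_zero hq0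
    (isRayClassCharacter_grossenChar hq ht) (exists_prime_grossenChar_ne_one hq χ 0 0 hν)
  refine ⟨G, hGd, fun s hs => ?_, hG1⟩
  refine eqOn_halfPlane_of_eqOn (θ := 8 / 9) (x₀ := 1) (by norm_num) hGd.differentiableOn
    (differentiableOn_grossenL hq χ 0 0 hν) (fun z hz => ?_) hs
  rw [hGeq z hz, grossenL_eq_rayClassLSeries hq χ 0 0 hν hz]

/-- **`L(1, ν^{(0,0)}) ≠ 0`** for every `χ ≠ χ₀ mod q` with `χ(u_E) = 1` — Hecke (1917) and Landau (1918);
the input `L_one_ne` of Siegel's theorem for Heath-Brown's real characters. [cite: HeathBrownActa2001, §9 p. 55] -/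
theorem grossenL_one_ne_zero (hq : 1 ≤ q) {χ : MulChar (QuotMod q) ℂ} (hχ : χ ≠ 1) (ht : charAngle χ = 0) :
    grossenL hq χ 0 0 1 ≠ 0 := by
  obtain ⟨G, -, hGeq, hG1⟩ := exists_entire_eq_grossenL hq hχ ht
  rwa [← hGeq 1 (by norm_num)]

/-- **`L(σ, ν^{(0,0)})` is real for real `σ > 8/9`** when `χ² = 1`, `t(χ) = 0` (real coefficients, Schwarz
reflection). [cite: MontgomeryVaughan2007, §10.1] -/
theorem grossenL_ofReal_im (hq : 1 ≤ q) {χ : MulChar (QuotMod q) ℂ} (h2 : χ ^ 2 = 1) (hχ : χ ≠ 1)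
    (ht : charAngle χ = 0) {σ : ℝ} (hσ : 8 / 9 < σ) : (grossenL hq χ 0 0 σ).im = 0 := by
  have hν : ¬ IsTrivialMod q (grossenChar hq χ 0 0) := fun h => hχ ((isTrivialMod_iff hq).mp h).1
  exact halfPlane_continuation_ofReal_im_eq_zero (conj_twistCount_grossenChar hq h2 ht) (x₀ := 1) (by norm_num)
    (differentiableOn_grossenL hq χ 0 0 hν) (fun s hs => grossenL_eq_LSeries hq χ 0 0 hν hs) hσ

/-! ### The conductor-aspect bound near `s = 1` -/

/-- **The trivial bound `‖∑_{n ≤ N} b(n)‖ ≤ c_K N`** for the twisted coefficients (ideal counting).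
[cite: HeathBrownActa2001, §9 p. 55] -/
theorem norm_sum_twistedCoeff_le_linear : ∃ c : ℝ, 1 ≤ c ∧ ∀ (q : ℕ) (hq : 1 ≤ q) (χ : MulChar (QuotMod q) ℂ)
    (j k : ℤ) (N : ℕ), 1 ≤ N → ‖∑ n ∈ Finset.Icc 1 N, twistedCoeff hq χ j k n‖ ≤ c * N := by
  obtain ⟨V, C₂, hV, hC₂, happ⟩ := exists_card_idealsUpTo_approx
  refine ⟨V + C₂ + 1, by linarith, fun q hq χ j k N hN => ?_⟩
  have hN1 : (1 : ℝ) ≤ N := by exact_mod_cast hN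
  have h1 : ‖∑ n ∈ Finset.Icc 1 N, twistedCoeff hq χ j k n‖ ≤ ((idealsUpTo N).card : ℝ) := by
    refine (norm_sum_le _ _).trans ?_
    rw [card_idealsUpTo_eq, Nat.cast_sum]
    exact Finset.sum_le_sum fun n _ => norm_twistedCoeff_le hq χ j k n
  have h2 := abs_le.mp (happ N hN)
  have h3 : (N : ℝ) ^ (2 / 3 : ℝ) ≤ N := by
    calc (N : ℝ) ^ (2 / 3 : ℝ) ≤ (N : ℝ) ^ (1 : ℝ) := Real.rpow_le_rpow_of_exponent_le hN1 (by norm_num)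
      _ = N := Real.rpow_one _
  nlinarith [h2.2, mul_le_mul_of_nonneg_left h3 hC₂]

/-- **Conductor-aspect bound for `L(s, ν^{(0,0)})` near `s = 1`**: for `0 < δ ≤ 3` there is `T(δ) ≥ 0` such that
for every `q ≥ 1`, every `χ ≠ χ₀ mod q` and every `s` with `1 − δ/54 ≤ Re s ≤ 4`,
`‖L(s, ν^{(0,0)})‖ ≤ T(δ) · q^δ · (|Im s| + 1)`. (Interpolate `|∑_{n≤N} b(n)| ≤ min(c_K N, Cq³N^{8/9})` to
`≤ c_K^{1−t}(Cq³)^tN^{1−t/9}`, `t = δ/3`, and apply `norm_contF_le` at `s + iΘ` with `Re s − (1 − t/9) ≥ t/18`.)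
[cite: MontgomeryVaughan2007, §11.2 Corollary 11.15] -/
theorem exists_norm_grossenL_le_rpow {δ : ℝ} (hδ : 0 < δ) (hδ3 : δ ≤ 3) :
    ∃ T : ℝ, 0 ≤ T ∧ ∀ (q : ℕ) (hq : 1 ≤ q) (χ : MulChar (QuotMod q) ℂ), χ ≠ 1 →
      ∀ s : ℂ, 1 - δ / 54 ≤ s.re → s.re ≤ 4 → ‖grossenL hq χ 0 0 s‖ ≤ T * (q : ℝ) ^ δ * (|s.im| + 1) := by
  obtain ⟨c, hc1, hc⟩ := norm_sum_twistedCoeff_le_linear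
  obtain ⟨C, hC0, hC⟩ := exists_sum_twistedCoeff_bound
  have hv := unitLog_pos
  obtain ⟨Θ₀, hΘ₀⟩ : ∃ Θ₀ : ℝ, Θ₀ = 2 * Real.pi / (3 * unitLog) := ⟨_, rfl⟩
  have hΘ₀0 : 0 ≤ Θ₀ := by rw [hΘ₀]; positivity
  obtain ⟨t, ht⟩ : ∃ t : ℝ, t = δ / 3 := ⟨_, rfl⟩
  have ht0 : 0 < t := by rw [ht]; positivity
  have ht1 : t ≤ 1 := by rw [ht]; linarith
  obtain ⟨C', hC'⟩ : ∃ C' : ℝ, C' = max C 1 := ⟨_, rfl⟩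
  have hC'1 : 1 ≤ C' := by rw [hC']; exact le_max_right _ _
  have hCC' : C ≤ C' := by rw [hC']; exact le_max_left _ _
  refine ⟨18 / t * (c * C') * (Θ₀ + 4), by positivity, fun q hq χ hχ s hs1 hs4 => ?_⟩
  have hν : ¬ IsTrivialMod q (grossenChar hq χ 0 0) := fun h => hχ ((isTrivialMod_iff hq).mp h).1
  have hq1 : (1 : ℝ) ≤ q := by exact_mod_cast hq
  have hq0 : (0 : ℝ) < q := by linarith
  have hc0 : (0 : ℝ) ≤ c := by linarith
  have hC'0 : (0 : ℝ) ≤ C' := by linarith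
  have hδt : δ = 3 * t := by rw [ht]; ring
  -- the interpolated partial-sum bound
  have hA : ∀ N : ℕ, 1 ≤ N → ‖∑ n ∈ Finset.Icc 1 N, twistedCoeff hq χ 0 0 n‖ ≤
      (c * C' * (q : ℝ) ^ (3 * t)) * (N : ℝ) ^ (1 - t / 9) := by
    intro N hN
    have hN1 : (1 : ℝ) ≤ N := by exact_mod_cast hN
    have hN0 : (0 : ℝ) < N := by linarith
    have h1 := hc q hq χ 0 0 N hN
    have h2 : ‖∑ n ∈ Finset.Icc 1 N, twistedCoeff hq χ 0 0 n‖ ≤ C' * (q : ℝ) ^ 3 * (N : ℝ) ^ (8 / 9 : ℝ) := by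
      have h := hC q hq χ 0 0 hν N hN
      simp only [Int.cast_zero, abs_zero, add_zero, mul_one] at h
      refine h.trans ?_
      gcongr
    -- interpolate the two bounds: `x ≤ A^{1−t}B^t` (cf. `Torus.le_rpow_one_sub_mul_rpow_of_le_of_le`)
    have h3 : ‖∑ n ∈ Finset.Icc 1 N, twistedCoeff hq χ 0 0 n‖ ≤
        (c * N) ^ (1 - t) * (C' * (q : ℝ) ^ 3 * (N : ℝ) ^ (8 / 9 : ℝ)) ^ t := by
      have hx := norm_nonneg (∑ n ∈ Finset.Icc 1 N, twistedCoeff hq χ 0 0 n)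
      rcases hx.eq_or_lt with h0 | hx0
      · rw [← h0]
        exact mul_nonneg (Real.rpow_nonneg (le_trans hx h1) _) (Real.rpow_nonneg (le_trans hx h2) _)
      calc ‖∑ n ∈ Finset.Icc 1 N, twistedCoeff hq χ 0 0 n‖
          = ‖∑ n ∈ Finset.Icc 1 N, twistedCoeff hq χ 0 0 n‖ ^ (1 - t) *
              ‖∑ n ∈ Finset.Icc 1 N, twistedCoeff hq χ 0 0 n‖ ^ t := by
            rw [← Real.rpow_add hx0]; norm_num
        _ ≤ (c * N) ^ (1 - t) * (C' * (q : ℝ) ^ 3 * (N : ℝ) ^ (8 / 9 : ℝ)) ^ t :=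
            mul_le_mul (Real.rpow_le_rpow hx h1 (by linarith)) (Real.rpow_le_rpow hx h2 ht0.le)
              (Real.rpow_nonneg hx _) (Real.rpow_nonneg (hx.trans h1) _)
    have hR : (c * N) ^ (1 - t) * (C' * (q : ℝ) ^ 3 * (N : ℝ) ^ (8 / 9 : ℝ)) ^ t =
        (c ^ (1 - t) * C' ^ t) * (q : ℝ) ^ (3 * t) * (N : ℝ) ^ (1 - t / 9) := by
      rw [Real.mul_rpow hc0 hN0.le, Real.mul_rpow (by positivity) (Real.rpow_nonneg hN0.le _),
        Real.mul_rpow hC'0 (by positivity), ← Real.rpow_natCast (q : ℝ) 3, ← Real.rpow_mul hq0.le,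
        ← Real.rpow_mul hN0.le]
      have hN : (N : ℝ) ^ (1 - t) * (N : ℝ) ^ ((8 / 9 : ℝ) * t) = (N : ℝ) ^ (1 - t / 9) := by
        rw [← Real.rpow_add hN0]; congr 1; ring
      rw [← hN]; push_cast; ring
    rw [hR] at h3
    refine h3.trans ?_
    have hcpow : c ^ (1 - t) * C' ^ t ≤ c * C' := by
      have h4 : c ^ (1 - t) ≤ c ^ (1 : ℝ) := Real.rpow_le_rpow_of_exponent_le hc1 (by linarith)
      have h5 : C' ^ t ≤ C' ^ (1 : ℝ) := Real.rpow_le_rpow_of_exponent_le hC'1 ht1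
      rw [Real.rpow_one] at h4 h5
      exact mul_le_mul h4 h5 (Real.rpow_nonneg hC'0 _) hc0
    gcongr
  -- apply `norm_contF_le` at `w = s + iΘ`
  have hθ0 : (0 : ℝ) ≤ 1 - t / 9 := by linarith
  obtain ⟨w, hw⟩ : ∃ w : ℂ, w = s + thetaOf χ 0 0 * I := ⟨_, rfl⟩
  have hwre : w.re = s.re := by rw [hw]; simp
  have hwim : w.im = s.im + thetaOf χ 0 0 := by rw [hw]; simp
  have hge : t / 18 ≤ w.re - (1 - t / 9) := by rw [hwre, hδt] at *; linarith
  have hsθ : 1 - t / 9 < w.re := by linarith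
  have h := norm_contF_le hθ0 hA hsθ
  have hgr : grossenL hq χ 0 0 s = contF (twistedCoeff hq χ 0 0) w := by rw [hw]; rfl
  rw [hgr]
  refine h.trans ?_
  have hΘ : |thetaOf χ 0 0| ≤ Θ₀ := by
    have h1 := abs_thetaOf_le χ 0 0
    simp only [Int.cast_zero, abs_zero, zero_add, mul_one] at h1
    rwa [hΘ₀]
  have hnw : ‖w‖ ≤ (Θ₀ + 4) * (|s.im| + 1) := by
    have h1 := Complex.norm_le_abs_re_add_abs_im w
    rw [hwre, hwim] at h1
    have h2 : |s.re| ≤ 4 := abs_le.mpr ⟨by linarith, hs4⟩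
    have h3 : |s.im + thetaOf χ 0 0| ≤ |s.im| + Θ₀ := (abs_add_le _ _).trans (by linarith)
    nlinarith [abs_nonneg s.im]
  have hden : c * C' * (q : ℝ) ^ (3 * t) / (w.re - (1 - t / 9)) ≤ c * C' * (q : ℝ) ^ (3 * t) * (18 / t) := by
    rw [div_eq_mul_inv]
    refine mul_le_mul_of_nonneg_left ?_ (by positivity)
    calc (w.re - (1 - t / 9))⁻¹ ≤ (t / 18)⁻¹ := inv_anti₀ (by positivity) hge
      _ = 18 / t := inv_div _ _
  calc ‖w‖ * (c * C' * (q : ℝ) ^ (3 * t) / (w.re - (1 - t / 9)))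
      ≤ ((Θ₀ + 4) * (|s.im| + 1)) * (c * C' * (q : ℝ) ^ (3 * t) * (18 / t)) :=
        mul_le_mul hnw hden (div_nonneg (by positivity) (by linarith)) (by positivity)
    _ = 18 / t * (c * C') * (Θ₀ + 4) * (q : ℝ) ^ δ * (|s.im| + 1) := by rw [hδt]; ring

end Literature.NumberTheory.Sieve.CubicSieve

end
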